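import Literature.NumberTheory.EllipticCurves.LocalKummerIsotropyTransport
import Literature.NumberTheory.EllipticCurves.CongruenceVisibility
import Summits.BirchSwinnertonDyer.Rank1Residual.X11b.WeilTransport
import HarnessLib

/-!
# Route `AdditiveKolyvaginRoad`, crux `LevelKolyvaginSystemsAdditive` (item stmt-BirchSwinnertonDyer-21396, KS′):
# THE LOCAL KUMMER CONDITION UNDER A CHANGE OF GROUND FIELD AT A FIXED LOCAL FIELD — brick B2a of the K-half of stub
# `stub_kummerLineAtP` of line `epsilon_matched_retyping` (cell `pub/bsd-wall`, width seat `bsd-wall-akr-p2x-w2` g4;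
# `--supports stmt-BirchSwinnertonDyer-21396`, helper; namespace `…Theorems.AdditiveKoly.KummerDescent`)

WHY. Stub S4 `stub_kummerLineAtP` of line `epsilon_matched_retyping` asks, at a prime `v ∣ p` of the Heegner field `K`
(`p` split), that E's Kummer condition and the `θ`-transport of E₀'s agree in `H¹(K_v, E[p])`. Its ℚ-half is landed
(`LagrangianSwitchAtP.map_kummer_eq_kummer_rat_of_p_parity`, p601209: the same identity in `H¹(ℚ_u, E[p])`, `u = v ∩ ℚ`).
The K-half is a DESCENT `ℚ_u ↝ K_v` of a local identity. This file supplies its first, purely algebraic half: for a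
tower of ground fields `F ⊆ K` and ONE local field `E` (a `K`-field, hence an `F`-field), the local Kummer condition
of `W/F` at the `F`-field `E` — a subgroup of `H¹(Γ_E, W[n](F̄))` — is carried ISOMORPHICALLY onto the local Kummer
condition of `W ⊗ K` at the `K`-field `E` — a subgroup of `H¹(Γ_E, (W ⊗ K)[n](K̄))` — by the change of
coefficients `β : W[n](F̄) ≃ (W ⊗ K)[n](K̄)` that matches the two torsion comparisons with `W(Ē)[n]`
(`torsionPointsEquiv` along the chosen embeddings `F̄ → Ē`, `K̄ → Ē`); and this transport is natural in
intertwining maps `φ : W₀[n] → W[n]`. (The second half — `ℚ_u` is a `K`-field for `v` of degree one, and the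
Selmer local kernel sees only the `K`-algebra class of the local field — is the sequel file.)

WHAT (namespace `…Theorems.AdditiveKoly.KummerDescent`; `F ⊆ K` fields of characteristic `0`, `E` a field with
`[Algebra F E] [Algebra K E] [IsScalarTower F K E]`, `W/F` elliptic, `n ≠ 0`).
* §0 generic `H¹` bookkeeping: `map_congr_apply`, `map_map_congr_apply` (pointwise functoriality on cocycles),
  `exists_intertwining_of_addEquiv` (intertwining maps `φ`, `ψ` of an equivariant `e : W₀[n] ≃ W[n]`, inverse to each
  other, with `H¹(φ) = h1Equiv e`).
* §1 `baseChange_baseChange_algebraicClosure_eq` (`(W ⊗ K) ⊗ Ē = W ⊗ Ē`), `congrEquiv_localPoints_smul`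
  (`Γ_E`-equivariance of the identification of local points).
* §2 for ANY additive isomorphism `β : W[n](F̄) ≃+ (W ⊗ K)[n](K̄)` matching the torsion comparisons
  (`hβ : congr (pointsMap (W ⊗ K) E (β P)) = pointsMap W E P`): `smul_of_pointsMap_eq` (`Γ_E`-equivariance),
  `exists_intertwining_of_pointsMap_eq` (the intertwining maps `B`, `B'` of `β`, `β⁻¹` between the RESTRICTED
  modules), **`map_kummerLocalConditionAt_eq_of_pointsMap_eq`**: `H¹(B)(𝓚_E(W)) = 𝓚_E(W ⊗ K)`.
* §3 `exists_addEquiv_pointsMap_eq` — such a `β` exists (`β = tpe_K⁻¹ ∘ congr ∘ tpe_F`).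
* §4 **`map_kummerLocalConditionAt_transport`** — naturality: if `β_W ∘ φ_F = φ_K ∘ β_{W₀}` pointwise then
  `φ_{F,*} 𝓚_E(W₀) = 𝓚_E(W) ⟹ φ_{K,*} 𝓚_E(W₀ ⊗ K) = 𝓚_E(W ⊗ K)`.

HONEST FRAMING: theorems only; 0 definitions, 0 named facts, 0 `sorry`; pure Galois-cohomological bookkeeping
(Serre, Galois Cohomology I §2.4: compatible pairs). Closes nothing by itself; BSD is not proved by any of this.

References: [cite: SerreGaloisCohomology1997, I §2.2, I §2.4, II §1.1] [cite: SilvermanAEC2009, VIII.§2, X.§4]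
[cite: MilneADT2006, Ch. I §6].
-/

-- single-conjunct summit: `Summit.BirchSwinnertonDyer.BirchSwinnertonDyer.…` repeats the name by design
set_option linter.dupNamespace false
set_option autoImplicit false

noncomputable section

open scoped Classical

universe u

namespace Summit.BirchSwinnertonDyer.BirchSwinnertonDyer.Theorems.AdditiveKoly.KummerDescent

open WeierstrassCurve Field
  Literature.NumberTheory.EllipticCurves Literature.NumberTheory.GaloisRepresentations
open scoped ContRepresentation

/-! ## §0 Generic `H¹` bookkeeping -/

section Generic

variable {L : Type u} [Field L] {M₁ M₂ M₃ : Type u}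
  [AddCommGroup M₁] [TopologicalSpace M₁] [DiscreteTopology M₁]
  [AddCommGroup M₂] [TopologicalSpace M₂] [DiscreteTopology M₂]
  [AddCommGroup M₃] [TopologicalSpace M₃] [DiscreteTopology M₃]
  {ρ₁ : DiscreteGaloisModule L M₁} {ρ₂ : DiscreteGaloisModule L M₂} {ρ₃ : DiscreteGaloisModule L M₃}

/-- `H¹(f) = H¹(f')` when `f = f'` pointwise. [cite: SerreGaloisCohomology1997, I §2.2] -/
theorem map_congr_apply (f f' : ρ₁.toContRepresentation →ⁱL ρ₂.toContRepresentation)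
    (h : ∀ a, f a = f' a) (x : galoisCohomology ρ₁ 1) :
    galoisCohomology.map f 1 x = galoisCohomology.map f' 1 x := by
  obtain ⟨φ, rfl⟩ := oneCocycleClass_surjective _ x
  rw [galoisCohomology.map_one_oneCocycleClass, galoisCohomology.map_one_oneCocycleClass]
  exact congrArg (oneCocycleClass _) (Subtype.ext (ContinuousMap.ext fun σ ↦ h (φ.1 σ)))

/-- **Pointwise functoriality of `H¹`**: `H¹(g) ∘ H¹(f) = H¹(g') ∘ H¹(f')` when `g ∘ f = g' ∘ f'` pointwise (both are
the class of `σ ↦ g (f (φ σ))`). [cite: SerreGaloisCohomology1997, I §2.2] -/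
theorem map_map_congr_apply {M₂' : Type u} [AddCommGroup M₂'] [TopologicalSpace M₂'] [DiscreteTopology M₂']
    {ρ₂' : DiscreteGaloisModule L M₂'}
    (f : ρ₁.toContRepresentation →ⁱL ρ₂.toContRepresentation)
    (g : ρ₂.toContRepresentation →ⁱL ρ₃.toContRepresentation)
    (f' : ρ₁.toContRepresentation →ⁱL ρ₂'.toContRepresentation)
    (g' : ρ₂'.toContRepresentation →ⁱL ρ₃.toContRepresentation)
    (h : ∀ a, g (f a) = g' (f' a)) (x : galoisCohomology ρ₁ 1) :
    galoisCohomology.map g 1 (galoisCohomology.map f 1 x) =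
      galoisCohomology.map g' 1 (galoisCohomology.map f' 1 x) := by
  obtain ⟨φ, rfl⟩ := oneCocycleClass_surjective _ x
  rw [galoisCohomology.map_one_oneCocycleClass, galoisCohomology.map_one_oneCocycleClass,
    galoisCohomology.map_one_oneCocycleClass, galoisCohomology.map_one_oneCocycleClass]
  exact congrArg (oneCocycleClass _) (Subtype.ext (ContinuousMap.ext fun σ ↦ h (φ.1 σ)))

/-- `H¹(g) (H¹(f) x) = H¹(k) x` when `g ∘ f = k` pointwise. [cite: SerreGaloisCohomology1997, I §2.2] -/
theorem map_map_eq_map_apply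
    (f : ρ₁.toContRepresentation →ⁱL ρ₂.toContRepresentation)
    (g : ρ₂.toContRepresentation →ⁱL ρ₃.toContRepresentation)
    (k : ρ₁.toContRepresentation →ⁱL ρ₃.toContRepresentation)
    (h : ∀ a, g (f a) = k a) (x : galoisCohomology ρ₁ 1) :
    galoisCohomology.map g 1 (galoisCohomology.map f 1 x) = galoisCohomology.map k 1 x := by
  obtain ⟨φ, rfl⟩ := oneCocycleClass_surjective _ x
  rw [galoisCohomology.map_one_oneCocycleClass, galoisCohomology.map_one_oneCocycleClass,
    galoisCohomology.map_one_oneCocycleClass]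
  exact congrArg (oneCocycleClass _) (Subtype.ext (ContinuousMap.ext fun σ ↦ h (φ.1 σ)))

/-- `H¹(k) (H¹(g) (H¹(f) x)) = H¹(l) x` when `k ∘ g ∘ f = l` pointwise. [cite: SerreGaloisCohomology1997, I §2.2] -/
theorem map_map_map_eq_map_apply {M₄ : Type u} [AddCommGroup M₄] [TopologicalSpace M₄] [DiscreteTopology M₄]
    {ρ₄ : DiscreteGaloisModule L M₄}
    (f : ρ₁.toContRepresentation →ⁱL ρ₂.toContRepresentation)
    (g : ρ₂.toContRepresentation →ⁱL ρ₃.toContRepresentation)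
    (k : ρ₃.toContRepresentation →ⁱL ρ₄.toContRepresentation)
    (l : ρ₁.toContRepresentation →ⁱL ρ₄.toContRepresentation)
    (h : ∀ a, k (g (f a)) = l a) (x : galoisCohomology ρ₁ 1) :
    galoisCohomology.map k 1 (galoisCohomology.map g 1 (galoisCohomology.map f 1 x)) = galoisCohomology.map l 1 x := by
  obtain ⟨φ, rfl⟩ := oneCocycleClass_surjective _ x
  rw [galoisCohomology.map_one_oneCocycleClass, galoisCohomology.map_one_oneCocycleClass,
    galoisCohomology.map_one_oneCocycleClass, galoisCohomology.map_one_oneCocycleClass]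
  exact congrArg (oneCocycleClass _) (Subtype.ext (ContinuousMap.ext fun σ ↦ h (φ.1 σ)))

/-- `H¹(g) (H¹(f) x) = x` when `g ∘ f = id` pointwise (the tree's `Levels.map_map_eq_self_of_comp_eq`, restated for the
namespace). [cite: SerreGaloisCohomology1997, I §2.2] -/
theorem map_map_eq_self_apply
    (f : ρ₁.toContRepresentation →ⁱL ρ₂.toContRepresentation)
    (g : ρ₂.toContRepresentation →ⁱL ρ₁.toContRepresentation)
    (h : ∀ a, g (f a) = a) (x : galoisCohomology ρ₁ 1) :
    galoisCohomology.map g 1 (galoisCohomology.map f 1 x) = x :=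
  Summit.BirchSwinnertonDyer.Rank1Residual.X11b.Levels.map_map_eq_self_of_comp_eq f g h x

end Generic

section AddEquivIntertwining

variable {L : Type u} [Field L] (W W₀ : WeierstrassCurve L) (n : ℤ)

/-- **Intertwining maps of an equivariant isomorphism `e : W₀[n] ≃ W[n]`, with `H¹(φ) = h1Equiv e`.** (The tree's
`CongruentTransfer.exists_intertwining_of_addEquiv_map_eq` at an arbitrary level `n : ℤ`.)
[cite: SerreGaloisCohomology1997, I §2.2 and §2.4] -/
theorem exists_intertwining_of_addEquiv (e : geomTorsion W₀ n ≃+ geomTorsion W n)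
    (he : ∀ (σ : absoluteGaloisGroup L) (P : geomTorsion W₀ n), e (σ • P) = σ • e P) :
    ∃ (φ : (W₀.torsionGaloisModule n).toContRepresentation →ⁱL (W.torsionGaloisModule n).toContRepresentation)
      (ψ : (W.torsionGaloisModule n).toContRepresentation →ⁱL (W₀.torsionGaloisModule n).toContRepresentation),
      (∀ a, φ a = e a) ∧ (∀ b, ψ b = e.symm b) ∧ (∀ a, ψ (φ a) = a) ∧ (∀ b, φ (ψ b) = b) ∧
      (∀ c : galoisCohomology (W₀.torsionGaloisModule n) 1, galoisCohomology.map φ 1 c = h1Equiv e he c) := by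
  refine ⟨{ toContinuousLinearMap := ⟨e.toAddMonoidHom.toIntLinearMap, continuous_of_discreteTopology⟩,
            isIntertwining' := fun σ ↦ ?_ },
          { toContinuousLinearMap := ⟨e.symm.toAddMonoidHom.toIntLinearMap, continuous_of_discreteTopology⟩,
            isIntertwining' := fun σ ↦ ?_ },
          fun a ↦ rfl, fun b ↦ rfl, fun a ↦ e.symm_apply_apply a, fun b ↦ e.apply_symm_apply b, fun c ↦ ?_⟩
  · ext P
    exact congrArg Subtype.val (he σ P)
  · ext Q
    exact congrArg Subtype.val (symm_equivariant e he σ Q)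
  · obtain ⟨f, rfl⟩ := oneCocycleClass_surjective _ c
    rw [galoisCohomology.map_one_oneCocycleClass]
    exact (h1Equiv_oneCocycleClass _ _ e he f).symm

end AddEquivIntertwining

/-! ## §1 One local field `E` over a tower of ground fields `F ⊆ K`: the local points and their Galois action -/

section Tower

variable {F K : Type u} [Field F] [Field K] [Algebra F K]
  (E : Type u) [Field E] [Algebra F E] [Algebra K E]
  (W : WeierstrassCurve F)

/-- `F → K → Ē` is `F → Ē` (both through `E`). [folklore] -/
theorem isScalarTower_algebraicClosure [IsScalarTower F K E] : IsScalarTower F K (AlgebraicClosure E) :=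
  IsScalarTower.of_algebraMap_eq fun x ↦ by
    rw [IsScalarTower.algebraMap_apply F E (AlgebraicClosure E), IsScalarTower.algebraMap_apply F K E,
      ← IsScalarTower.algebraMap_apply K E (AlgebraicClosure E)]

/-- **`(W ⊗_F K) ⊗_K Ē = W ⊗_F Ē`** for a `K`-field `E` over the tower `F ⊆ K`. [folklore] -/
theorem baseChange_baseChange_algebraicClosure_eq [IsScalarTower F K E] :
    (W.baseChange K).baseChange (AlgebraicClosure E) = W.baseChange (AlgebraicClosure E) := by
  haveI := isScalarTower_algebraicClosure (F := F) (K := K) E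
  change (W.map (algebraMap F K)).map (algebraMap K (AlgebraicClosure E)) = W.map (algebraMap F (AlgebraicClosure E))
  rw [WeierstrassCurve.map_map, ← IsScalarTower.algebraMap_eq]

/-- **The identification of local points `(W ⊗ K)(Ē) = W(Ē)` is `Γ_E`-equivariant** (both actions are `σ` on
coordinates: through `Aut_K(Ē)`, resp. `Aut_F(Ē)`). [cite: SilvermanAEC2009, VIII.§1] -/
theorem congrEquiv_localPoints_smul (h : (W.baseChange K).baseChange (AlgebraicClosure E) = W.baseChange (AlgebraicClosure E))
    (σ : absoluteGaloisGroup E) (P : localPoints (W.baseChange K) E) :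
    (show localPoints (W.baseChange K) E ≃+ localPoints W E from Affine.Point.congrEquiv h) (σ • P) =
      σ • (show localPoints (W.baseChange K) E ≃+ localPoints W E from Affine.Point.congrEquiv h) P := by
  rw [localPoints.smul_def, localPoints.smul_def]
  change Affine.Point.congrEquiv h (Affine.Point.map _ P) = Affine.Point.map _ (Affine.Point.congrEquiv h P)
  rcases P with _ | ⟨x, y, hxy⟩
  · change Affine.Point.congrEquiv h (Affine.Point.map _ 0) = Affine.Point.map _ (Affine.Point.congrEquiv h 0)
    simp only [map_zero]
  · rw [Affine.Point.map_some, Affine.Point.congrEquiv_some, Affine.Point.congrEquiv_some, Affine.Point.map_some]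
    rfl

end Tower

/-! ## §2 A change of coefficients `β : W[n](F̄) ≃ (W ⊗ K)[n](K̄)` matching the torsion comparisons -/

section Beta

variable {F K : Type u} [Field F] [Field K] [Algebra F K]
  (E : Type u) [Field E] [Algebra F E] [Algebra K E]
  (W : WeierstrassCurve F) (n : ℤ)
  (h : (W.baseChange K).baseChange (AlgebraicClosure E) = W.baseChange (AlgebraicClosure E))
  (β : geomTorsion W n ≃+ geomTorsion (W.baseChange K) n)
  (hβ : ∀ P : geomTorsion W n,
    (show localPoints (W.baseChange K) E ≃+ localPoints W E from Affine.Point.congrEquiv h)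
        (pointsMap (W.baseChange K) E (β P : geomTorsion (W.baseChange K) n)) =
      pointsMap W E (P : geomPoints W))

include hβ

/-- **`β` is `Γ_E`-equivariant** for the restricted actions (`Γ_E → Γ_F` on `W[n](F̄)`, `Γ_E → Γ_K` on `(W ⊗ K)[n](K̄)`):
both `pointsMap`s are equivariant and injective, and `congr` is equivariant. [cite: SerreGaloisCohomology1997, I §2.4] -/
theorem smul_of_pointsMap_eq (σ : absoluteGaloisGroup E) (P : geomTorsion W n) :
    β (resGal (K := F) E σ • P) = resGal (K := K) E σ • β P := by
  apply Subtype.ext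
  apply pointsMapOfEmb_injective (W.baseChange K) (closureEmb (K := K) E)
  apply (show localPoints (W.baseChange K) E ≃+ localPoints W E from Affine.Point.congrEquiv h).injective
  change (show localPoints (W.baseChange K) E ≃+ localPoints W E from Affine.Point.congrEquiv h)
      (pointsMap (W.baseChange K) E (β (resGal (K := F) E σ • P) : geomTorsion (W.baseChange K) n)) =
    (show localPoints (W.baseChange K) E ≃+ localPoints W E from Affine.Point.congrEquiv h)
      (pointsMap (W.baseChange K) E ((resGal (K := K) E σ • β P : geomTorsion (W.baseChange K) n) :
        geomPoints (W.baseChange K)))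
  rw [hβ, AddSubgroup.torsionBy.coe_smul, AddSubgroup.torsionBy.coe_smul, pointsMap_smul, pointsMap_smul,
    congrEquiv_localPoints_smul E W h, hβ]

/-- **The intertwining maps of `β` and `β⁻¹` between the RESTRICTED modules** `W[n](F̄)|_{Γ_E}` and
`(W ⊗ K)[n](K̄)|_{Γ_E}` (`GaloisRep.restrictField E` of the two torsion Galois modules). [cite: SerreGaloisCohomology1997, I §2.4] -/
theorem exists_intertwining_of_pointsMap_eq :
    ∃ (B : (GaloisRep.restrictField E (W.torsionGaloisModule n)).toContRepresentation →ⁱL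
        (GaloisRep.restrictField E ((W.baseChange K).torsionGaloisModule n)).toContRepresentation)
      (B' : (GaloisRep.restrictField E ((W.baseChange K).torsionGaloisModule n)).toContRepresentation →ⁱL
        (GaloisRep.restrictField E (W.torsionGaloisModule n)).toContRepresentation),
      (∀ a, B a = β a) ∧ (∀ b, B' b = β.symm b) := by
  have hsm := smul_of_pointsMap_eq E W n h β hβ
  have hsm' : ∀ (σ : absoluteGaloisGroup E) (Q : geomTorsion (W.baseChange K) n),
      β.symm (resGal (K := K) E σ • Q) = resGal (K := F) E σ • β.symm Q := fun σ Q ↦ by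
    apply β.injective
    rw [AddEquiv.apply_symm_apply, hsm, AddEquiv.apply_symm_apply]
  refine ⟨{ toContinuousLinearMap := ⟨β.toAddMonoidHom.toIntLinearMap, continuous_of_discreteTopology⟩,
            isIntertwining' := fun σ ↦ ?_ },
          { toContinuousLinearMap := ⟨β.symm.toAddMonoidHom.toIntLinearMap, continuous_of_discreteTopology⟩,
            isIntertwining' := fun σ ↦ ?_ }, fun a ↦ rfl, fun b ↦ rfl⟩
  · ext P
    exact congrArg Subtype.val (hsm σ P)
  · ext Q
    exact congrArg Subtype.val (hsm' σ Q)

/-- **THE LOCAL KUMMER CONDITION UNDER THE CHANGE OF GROUND FIELD `F ↝ K` AT THE FIXED LOCAL FIELD `E`.** For any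
intertwining maps `B`, `B'` of the restricted modules that are `β`, `β⁻¹` on points: `H¹(B)` maps the local Kummer condition
`𝓚_E(W) = ker (H¹(Γ_E, W[n](F̄)) → H¹(Γ_E, W(Ē)))` ONTO `𝓚_E(W ⊗ K) = ker (H¹(Γ_E, (W ⊗ K)[n](K̄)) → H¹(Γ_E, (W ⊗ K)(Ē)))`
— the two kernels are taken along `E[n] ↪ E(Ē)` through the two torsion comparisons, which `β` matches, and the targets are
identified by `(W ⊗ K)(Ē) = W(Ē)` (`congr`, `Γ_E`-equivariant). [cite: SerreGaloisCohomology1997, I §2.4]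
[cite: SilvermanAEC2009, X.§4] -/
theorem map_kummerLocalConditionAt_eq_of_pointsMap_eq
    (B : (GaloisRep.restrictField E (W.torsionGaloisModule n)).toContRepresentation →ⁱL
      (GaloisRep.restrictField E ((W.baseChange K).torsionGaloisModule n)).toContRepresentation)
    (B' : (GaloisRep.restrictField E ((W.baseChange K).torsionGaloisModule n)).toContRepresentation →ⁱL
      (GaloisRep.restrictField E (W.torsionGaloisModule n)).toContRepresentation)
    (hB : ∀ a, B a = β a) (hB' : ∀ b, B' b = β.symm b) :
    (W.kummerLocalConditionAt n E).map (galoisCohomology.map B 1) = (W.baseChange K).kummerLocalConditionAt n E := by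
  -- the identification of the local points, as intertwining maps `C`, `C'`
  let pc : localPoints (W.baseChange K) E ≃+ localPoints W E := Affine.Point.congrEquiv h
  have hpc : ∀ (σ : absoluteGaloisGroup E) (P : localPoints (W.baseChange K) E), pc (σ • P) = σ • pc P :=
    congrEquiv_localPoints_smul E W h
  have hpc' : ∀ (σ : absoluteGaloisGroup E) (Q : localPoints W E), pc.symm (σ • Q) = σ • pc.symm Q := fun σ Q ↦ by
    apply pc.injective
    rw [AddEquiv.apply_symm_apply, hpc, AddEquiv.apply_symm_apply]
  let C : ((W.baseChange K).localGaloisModule E).toContRepresentation →ⁱL (W.localGaloisModule E).toContRepresentation :=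
    { toContinuousLinearMap := ⟨pc.toAddMonoidHom.toIntLinearMap, continuous_of_discreteTopology⟩
      isIntertwining' := fun σ ↦ ContinuousLinearMap.ext fun P ↦ hpc σ P }
  let C' : (W.localGaloisModule E).toContRepresentation →ⁱL ((W.baseChange K).localGaloisModule E).toContRepresentation :=
    { toContinuousLinearMap := ⟨pc.symm.toAddMonoidHom.toIntLinearMap, continuous_of_discreteTopology⟩
      isIntertwining' := fun σ ↦ ContinuousLinearMap.ext fun Q ↦ hpc' σ Q }
  have hCC' : ∀ P, C' (C P) = P := fun P ↦ pc.symm_apply_apply P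
  have hBB' : ∀ b, B (B' b) = b := fun b ↦ by rw [hB, hB']; exact β.apply_symm_apply b
  -- the square `C ∘ tK ∘ B = tF` on points
  have hsq : ∀ a, C ((W.baseChange K).torsionPointsMapIntertwining n E (B a)) = W.torsionPointsMapIntertwining n E a :=
    fun a ↦ by
      rw [torsionPointsMapIntertwining_apply, torsionPointsMapIntertwining_apply, hB]
      exact hβ a
  -- hence `x ∈ 𝓚_E(W) ↔ H¹(B) x ∈ 𝓚_E(W ⊗ K)`
  have key : ∀ x, x ∈ W.kummerLocalConditionAt n E ↔
      galoisCohomology.map B 1 x ∈ (W.baseChange K).kummerLocalConditionAt n E := fun x ↦ by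
    rw [mem_kummerLocalConditionAt_iff, mem_kummerLocalConditionAt_iff,
      ← map_map_map_eq_map_apply B ((W.baseChange K).torsionPointsMapIntertwining n E) C
        (W.torsionPointsMapIntertwining n E) hsq x]
    constructor
    · intro h0
      apply Summit.BirchSwinnertonDyer.Rank1Residual.X11b.Levels.map_injective_of_comp_eq C C' hCC'
      rw [h0, map_zero]
    · intro h0
      rw [h0, map_zero]
  ext y
  constructor
  · rintro ⟨x, hx, rfl⟩
    exact (key x).mp hx
  · intro hy
    refine ⟨galoisCohomology.map B' 1 y, ?_, map_map_eq_self_apply B' B hBB' y⟩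
    rw [SetLike.mem_coe, key, map_map_eq_self_apply B' B hBB' y]
    exact hy

end Beta

/-! ## §3 Existence of `β`: `tpe_K⁻¹ ∘ congr ∘ tpe_F` -/

section Existence

variable {F K : Type u} [Field F] [Field K] [Algebra F K] [CharZero F] [CharZero K]
  (E : Type u) [Field E] [Algebra F E] [Algebra K E]
  (W : WeierstrassCurve F) [W.IsElliptic] [(W.baseChange K).IsElliptic] {n : ℤ}
  (h : (W.baseChange K).baseChange (AlgebraicClosure E) = W.baseChange (AlgebraicClosure E))

/-- **A change of coefficients `β : W[n](F̄) ≃+ (W ⊗ K)[n](K̄)` matching the torsion comparisons EXISTS**: both torsion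
comparisons `W[n](F̄) ≃ W(Ē)[n]`, `(W ⊗ K)[n](K̄) ≃ (W ⊗ K)(Ē)[n]` are bijections (`torsionPointsEquiv`, Silverman III.6.4(b):
all the `n`-torsion is algebraic), and `(W ⊗ K)(Ē) = W(Ē)`. [cite: SilvermanAEC2009, Cor. III.6.4(b)] -/
theorem exists_addEquiv_pointsMap_eq (hn : n ≠ 0) :
    ∃ β : geomTorsion W n ≃+ geomTorsion (W.baseChange K) n, ∀ P : geomTorsion W n,
      (show localPoints (W.baseChange K) E ≃+ localPoints W E from Affine.Point.congrEquiv h)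
          (pointsMap (W.baseChange K) E (β P : geomTorsion (W.baseChange K) n)) =
        pointsMap W E (P : geomPoints W) := by
  let pc : localPoints (W.baseChange K) E ≃+ localPoints W E := Affine.Point.congrEquiv h
  let tF := W.torsionPointsEquiv n (E := E) hn
  let tK := (W.baseChange K).torsionPointsEquiv n (E := E) hn
  refine ⟨tF.trans ((torsionByCongr pc.symm n).trans tK.symm), fun P ↦ ?_⟩
  change pc (pointsMap (W.baseChange K) E ((tK.symm (torsionByCongr pc.symm n (tF P)) :
      geomTorsion (W.baseChange K) n) : geomPoints (W.baseChange K))) = _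
  rw [pointsMap_torsionPointsEquiv_symm, coe_torsionByCongr_apply, AddEquiv.apply_symm_apply,
    coe_torsionPointsEquiv_apply]

end Existence

/-! ## §4 Naturality: the transport commutes with intertwining maps, hence carries identities of Kummer conditions -/

section Naturality

variable {F K : Type u} [Field F] [Field K] [Algebra F K]
  (E : Type u) [Field E] [Algebra F E] [Algebra K E]
  (W W₀ : WeierstrassCurve F) (n : ℤ)
  (h : (W.baseChange K).baseChange (AlgebraicClosure E) = W.baseChange (AlgebraicClosure E))
  (h₀ : (W₀.baseChange K).baseChange (AlgebraicClosure E) = W₀.baseChange (AlgebraicClosure E))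
  (βW : geomTorsion W n ≃+ geomTorsion (W.baseChange K) n)
  (hβW : ∀ P : geomTorsion W n,
    (show localPoints (W.baseChange K) E ≃+ localPoints W E from Affine.Point.congrEquiv h)
        (pointsMap (W.baseChange K) E (βW P : geomTorsion (W.baseChange K) n)) =
      pointsMap W E (P : geomPoints W))
  (βW₀ : geomTorsion W₀ n ≃+ geomTorsion (W₀.baseChange K) n)
  (hβW₀ : ∀ P : geomTorsion W₀ n,
    (show localPoints (W₀.baseChange K) E ≃+ localPoints W₀ E from Affine.Point.congrEquiv h₀)
        (pointsMap (W₀.baseChange K) E (βW₀ P : geomTorsion (W₀.baseChange K) n)) =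
      pointsMap W₀ E (P : geomPoints W₀))

include hβW hβW₀

/-- **TRANSPORT OF AN IDENTITY OF LOCAL KUMMER CONDITIONS ALONG THE CHANGE OF GROUND FIELD.** Let `φ_F : W₀[n] → W[n]`
(over `F`) and `φ_K : (W₀ ⊗ K)[n] → (W ⊗ K)[n]` (over `K`) be intertwining maps with `β_W ∘ φ_F = φ_K ∘ β_{W₀}` on points.
If `φ_{F,*} 𝓚_E(W₀) = 𝓚_E(W)` in `H¹(Γ_E, W[n](F̄))`, then `φ_{K,*} 𝓚_E(W₀ ⊗ K) = 𝓚_E(W ⊗ K)` in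
`H¹(Γ_E, (W ⊗ K)[n](K̄))`: both sides are the images under `H¹(B_W)`, `H¹(B_{W₀})` (§2), and
`H¹(B_W) ∘ H¹(φ_F) = H¹(φ_K) ∘ H¹(B_{W₀})`. [cite: SerreGaloisCohomology1997, I §2.4] [cite: SilvermanAEC2009, X.§4] -/
theorem map_kummerLocalConditionAt_transport
    (φF : (W₀.torsionGaloisModule n).toContRepresentation →ⁱL (W.torsionGaloisModule n).toContRepresentation)
    (φK : ((W₀.baseChange K).torsionGaloisModule n).toContRepresentation →ⁱL
      ((W.baseChange K).torsionGaloisModule n).toContRepresentation)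
    (hcomm : ∀ P, βW (φF P) = φK (βW₀ P))
    (hF : (W₀.kummerLocalConditionAt n E).map (galoisCohomology.map (φF.restrictField E) 1) =
      W.kummerLocalConditionAt n E) :
    ((W₀.baseChange K).kummerLocalConditionAt n E).map (galoisCohomology.map (φK.restrictField E) 1) =
      (W.baseChange K).kummerLocalConditionAt n E := by
  obtain ⟨B, B', hB, hB'⟩ := exists_intertwining_of_pointsMap_eq E W n h βW hβW
  obtain ⟨B₀, B₀', hB₀, hB₀'⟩ := exists_intertwining_of_pointsMap_eq E W₀ n h₀ βW₀ hβW₀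
  rw [← map_kummerLocalConditionAt_eq_of_pointsMap_eq E W₀ n h₀ βW₀ hβW₀ B₀ B₀' hB₀ hB₀',
    ← map_kummerLocalConditionAt_eq_of_pointsMap_eq E W n h βW hβW B B' hB hB', ← hF, AddSubgroup.map_map,
    AddSubgroup.map_map]
  congr 1
  refine AddMonoidHom.ext fun x ↦ ?_
  change galoisCohomology.map (φK.restrictField E) 1 (galoisCohomology.map B₀ 1 x) =
    galoisCohomology.map B 1 (galoisCohomology.map (φF.restrictField E) 1 x)
  refine map_map_congr_apply B₀ (φK.restrictField E) (φF.restrictField E) B (fun a ↦ ?_) x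
  rw [ContIntertwiningMap.restrictField_apply, ContIntertwiningMap.restrictField_apply, hB₀, hB, hcomm]

end Naturality

end Summit.BirchSwinnertonDyer.BirchSwinnertonDyer.Theorems.AdditiveKoly.KummerDescent

end
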